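import Summits.ResolutionOfSingularities.ResolutionOfSingularities.Theorems.FrobeniusLadderFInjectiveMacaulayficationCNStrongPlusStepRel
import HarnessLib

/-!
# T-𝒫 §3b — THE CN ENGINE'S CERTIFICATES, `hoff`-FREE, IN E6‴ COVER FORMAT (`cnCertificates`)
# (crux `FInjectiveMacaulayfication` stmt-ResolutionOfSingularities-15315, chain w45a; res-L1-w45a-plan-1 CRUX-PLAN v10 R10.3 /
# `L/w45a/ClassGlueSig.lean` v2 `239444958d057f2d` §3b — owner res-D-pv-017 AS res-L1-w45a-stub-5)

Support file for crux stmt-ResolutionOfSingularities-15315 (`FrobeniusLadder.FInjectiveMacaulayfication`), chain w45a.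
[OURS · L1 W4.5a] — NOT a statement of any manuscript; AI-written, weaker than expert review.

The CN engine G5ᴾ (`CNConeFiModel.cnConeFiModel` p495573 / `…Prime` p496198) feeds `cnConeFiModel_of_chartClause` a `hon` block
(the Cohen–Macaulay + Frobenius-closed clause on every vertex chart `R[I_A R/x̄^(m_c)]` at its maximal ideals containing `x̄^(m_c)/1`),
the Rees COVER inequality and `x̄^(m_c) ≠ 0`, and uses `hoff` only OFF the centre. T-𝒫 (the engine-class door theorem, ClassGlueSig §2)
wants exactly the `hoff`-FREE part as a CERTIFICATE in E6‴'s format for `R = k[X]/(f)`, `I = I_A·R`, `v c = x̄^(m_c)`: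
`cnCertificates` = ⟨cover, non-vanishing, hon⟩ ∧ «`I_A R ≤ P ↔ every x̄ᵢ ∈ P`» (zero locus = the origin), from the binders of
`cnConeFiModel_of_isPrime` MINUS `hoff` (the `hunit`-free prime form; add the unused binder to recover p495573's block). Proof: the chart
half is `CNConeFiModelRelBlowup.chartClause_of_cnData` (p498340) at `J = univ`, the cover is `ReesCoverOfPowers.stub_reesCoverOfPowers`, the
zero locus is `CNStrongPlusStepRel.centre_le_iff` (p499436) at `J = univ`. No definitions, no named facts. [folklore]
-/

-- single-problem summit: the doubled namespace component is forced
set_option linter.dupNamespace false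

noncomputable section

open AlgebraicGeometry CategoryTheory Literature.AlgebraicGeometry.Resolution MvPolynomial

namespace Summit.ResolutionOfSingularities.ResolutionOfSingularities.Theorems.FInjectiveMacaulayfication.CNCertificates

open Summit.ResolutionOfSingularities.ResolutionOfSingularities.Theorems.FInjectiveMacaulayfication

set_option maxHeartbeats 800000 in
/-- **T-𝒫 §3b `cnCertificates` — the CN engine's certificates without `hoff`** (ClassGlueSig v2 `239444958d057f2d` §3b): from the
binders of `CNConeFiModelPrime.cnConeFiModel_of_isPrime` minus `hoff`, for `R = k[X]/(f)`, `I = I_A·R`, `v c = x̄^(m_c)` (all in `I`):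
(i) the Rees charts of the `v c` COVER `Bl_I`; (ii) every `v c ≠ 0`; (iii) every affine blow-up algebra `R[I/v c]` satisfies the
Cohen–Macaulay + Frobenius-closed clause at its maximal ideals containing `v c/1`; (iv) a prime contains `I` iff it contains every `x̄ᵢ`.
[folklore] -/
theorem cnCertificates (p : ℕ) [Fact p.Prime] (k : Type) [Field k] [CharP k p] (n : ℕ) (hn : 0 < n)
    (A : Finset (Fin n →₀ ℕ)) (hA0 : (0 : Fin n →₀ ℕ) ∉ A)
    (hprim : ∀ j : Fin n, ∃ e : ℕ, 0 < e ∧ Finsupp.single j e ∈ A)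
    (t : ℕ) (_ht : 0 < t) (V : Fin t → Matrix (Fin n) (Fin n) ℕ) (hV : ∀ c, IsUnit ((V c).map (Nat.cast : ℕ → ℤ)).det)
    (m : Fin t → (Fin n →₀ ℕ)) (hm : ∀ c, m c ∈ A) (a : Fin t → Fin n → (Fin n →₀ ℕ)) (haA : ∀ c i, a c i ∈ A)
    (hgen : ∀ (c : Fin t) (i : Fin n), (Finsupp.equivFunOnFinite.symm ((V c).mulVec ⇑(a c i)) : Fin n →₀ ℕ) =
      Finsupp.equivFunOnFinite.symm ((V c).mulVec ⇑(m c)) + Finsupp.single i 1)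
    (hge : ∀ (c : Fin t), ∀ e ∈ A, (Finsupp.equivFunOnFinite.symm ((V c).mulVec ⇑(m c)) : Fin n →₀ ℕ) ≤
      Finsupp.equivFunOnFinite.symm ((V c).mulVec ⇑e))
    (hcov : ∀ e ∈ A, ∃ (c : Fin t) (K : ℕ), 1 ≤ K ∧ ∃ y ∈ (Ideal.span ((fun b : Fin n →₀ ℕ => (MvPolynomial.monomial b (1 : k) : MvPolynomial (Fin n) k)) '' (A : Set (Fin n →₀ ℕ)))) ^ (K - 1),
      (MvPolynomial.monomial e (1 : k) : MvPolynomial (Fin n) k) ^ K = MvPolynomial.monomial (m c) 1 * y)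
    (f : MvPolynomial (Fin n) k) (hfprime : (Ideal.span {f}).IsPrime)
    (hXne : ∀ v : Fin n, Ideal.Quotient.mk (Ideal.span {f}) (MvPolynomial.X v) ≠ 0)
    (hCN : ∀ (c : Fin t) (S : Finset (Fin n)), (∀ j : Fin n, 0 < ∑ i ∈ S, V c i j) →
      (∀ D : ℕ, (MvPolynomial.weightedHomogeneousComponent (fun j : Fin n => ∑ i ∈ S, V c i j) D f ≠ 0 ∧
          ∀ D' < D, MvPolynomial.weightedHomogeneousComponent (fun j : Fin n => ∑ i ∈ S, V c i j) D' f = 0) →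
        ∀ (K : Type) [Field K] [Algebra k K] (b : Fin n → K), (∀ i, b i ≠ 0) →
          MvPolynomial.aeval b (MvPolynomial.weightedHomogeneousComponent (fun j : Fin n => ∑ i ∈ S, V c i j) D f) = 0 →
          (MvPolynomial.map (algebraMap k K) (MvPolynomial.weightedHomogeneousComponent (fun j : Fin n => ∑ i ∈ S, V c i j) D f)) ^ (p - 1) ∉
            Ideal.span (Set.range fun i : Fin n => (MvPolynomial.X i - MvPolynomial.C (b i)) ^ p)))
    (dv : Fin t → (Fin n →₀ ℕ)) (g : Fin t → MvPolynomial (Fin n) k)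
    (hg : ∀ c, MvPolynomial.aeval (fun j : Fin n => ∏ i : Fin n, (MvPolynomial.X i : MvPolynomial (Fin n) k) ^ V c i j) f = MvPolynomial.monomial (dv c) 1 * g c)
    (hndiv : ∀ c, ∀ i : Fin n, ¬ (MvPolynomial.X i ∣ g c))
    (hface : ∀ c, ∃ m ∈ f.support, ∀ i : Fin n, ∑ j : Fin n, V c i j * m j = dv c i) :
    (∃ hv : ∀ c : Fin t, (fun c : Fin t => Ideal.Quotient.mk (Ideal.span {f}) (MvPolynomial.monomial (m c) (1 : k))) c ∈ (Ideal.span ((fun b : Fin n →₀ ℕ => Ideal.Quotient.mk (Ideal.span {f}) (MvPolynomial.monomial b (1 : k))) '' (A : Set (Fin n →₀ ℕ)))),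
      (HomogeneousIdeal.irrelevant (reesGrading (Ideal.span ((fun b : Fin n →₀ ℕ => Ideal.Quotient.mk (Ideal.span {f}) (MvPolynomial.monomial b (1 : k))) '' (A : Set (Fin n →₀ ℕ)))))).toIdeal ≤
          (Ideal.span (Set.range fun c : Fin t => reesT (I := (Ideal.span ((fun b : Fin n →₀ ℕ => Ideal.Quotient.mk (Ideal.span {f}) (MvPolynomial.monomial b (1 : k))) '' (A : Set (Fin n →₀ ℕ))))) ((fun c : Fin t => Ideal.Quotient.mk (Ideal.span {f}) (MvPolynomial.monomial (m c) (1 : k))) c) (hv c))).radical ∧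
        (∀ c : Fin t, (fun c : Fin t => Ideal.Quotient.mk (Ideal.span {f}) (MvPolynomial.monomial (m c) (1 : k))) c ≠ 0) ∧
        ∀ (c : Fin t) (Q : Ideal (blowupAlgebra (Ideal.span ((fun b : Fin n →₀ ℕ => Ideal.Quotient.mk (Ideal.span {f}) (MvPolynomial.monomial b (1 : k))) '' (A : Set (Fin n →₀ ℕ)))) ((fun c : Fin t => Ideal.Quotient.mk (Ideal.span {f}) (MvPolynomial.monomial (m c) (1 : k))) c))) [Q.IsMaximal],
          algebraMap (MvPolynomial (Fin n) k ⧸ Ideal.span {f}) (blowupAlgebra (Ideal.span ((fun b : Fin n →₀ ℕ => Ideal.Quotient.mk (Ideal.span {f}) (MvPolynomial.monomial b (1 : k))) '' (A : Set (Fin n →₀ ℕ)))) ((fun c : Fin t => Ideal.Quotient.mk (Ideal.span {f}) (MvPolynomial.monomial (m c) (1 : k))) c)) ((fun c : Fin t => Ideal.Quotient.mk (Ideal.span {f}) (MvPolynomial.monomial (m c) (1 : k))) c) ∈ Q →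
          ∀ d : ℕ, ringKrullDim (Localization.AtPrime Q) = d → ∀ s : Fin d → Localization.AtPrime Q,
            (Ideal.span (Set.range s)).radical.IsMaximal →
              RingTheory.Sequence.IsWeaklyRegular (Localization.AtPrime Q) (List.ofFn s) ∧
              ∀ y : Localization.AtPrime Q, (∃ e : ℕ, y ^ p ^ e ∈ Ideal.span
                ((fun z : Localization.AtPrime Q => z ^ p ^ e) ''
                  (Ideal.span (Set.range s) : Set (Localization.AtPrime Q)))) → y ∈ Ideal.span (Set.range s)) ∧
      ∀ (P : Ideal (MvPolynomial (Fin n) k ⧸ Ideal.span {f})) [P.IsPrime], (Ideal.span ((fun b : Fin n →₀ ℕ => Ideal.Quotient.mk (Ideal.span {f}) (MvPolynomial.monomial b (1 : k))) '' (A : Set (Fin n →₀ ℕ)))) ≤ P ↔ ∀ i : Fin n, Ideal.Quotient.mk (Ideal.span {f}) (MvPolynomial.X i) ∈ P := by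
  classical
  haveI := hfprime
  haveI : IsDomain (MvPolynomial (Fin n) k ⧸ Ideal.span {f}) := Ideal.Quotient.isDomain _
  have hv : ∀ c : Fin t, (fun c : Fin t => Ideal.Quotient.mk (Ideal.span {f}) (MvPolynomial.monomial (m c) (1 : k))) c ∈ (Ideal.span ((fun b : Fin n →₀ ℕ => Ideal.Quotient.mk (Ideal.span {f}) (MvPolynomial.monomial b (1 : k))) '' (A : Set (Fin n →₀ ℕ)))) := fun c => Ideal.subset_span ⟨m c, hm c, rfl⟩
  have hImap : (Ideal.span ((fun b : Fin n →₀ ℕ => Ideal.Quotient.mk (Ideal.span {f}) (MvPolynomial.monomial b (1 : k))) '' (A : Set (Fin n →₀ ℕ)))) = (Ideal.span ((fun b : Fin n →₀ ℕ => (MvPolynomial.monomial b (1 : k) : MvPolynomial (Fin n) k)) '' (A : Set (Fin n →₀ ℕ)))).map (Ideal.Quotient.mk (Ideal.span {f})) := by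
    rw [Ideal.map_span, Set.image_image]
  refine ⟨⟨hv, ?_, fun c => CNConeFiModel.mk_monomial_ne_zero f hXne (m c), ?_⟩, ?_⟩
  · -- the cover, read off the identities `(x^e)^K = x^(m c) · y`
    refine ReesCoverOfPowers.stub_reesCoverOfPowers _ (Ideal.span ((fun b : Fin n →₀ ℕ => Ideal.Quotient.mk (Ideal.span {f}) (MvPolynomial.monomial b (1 : k))) '' (A : Set (Fin n →₀ ℕ)))) (Ideal.Quotient.mk (Ideal.span {f}) '' ((fun b : Fin n →₀ ℕ => (MvPolynomial.monomial b (1 : k) : MvPolynomial (Fin n) k)) '' (A : Set (Fin n →₀ ℕ)))) (by rw [hImap, Ideal.map_span]) t (fun c : Fin t => Ideal.Quotient.mk (Ideal.span {f}) (MvPolynomial.monomial (m c) (1 : k))) hv ?_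
    rintro _ ⟨_, ⟨e, he, rfl⟩, rfl⟩
    obtain ⟨c, K, hK, y, hy, hEq⟩ := hcov e he
    refine ⟨c, K, hK, Ideal.Quotient.mk (Ideal.span {f}) y, ?_, ?_⟩
    · rw [hImap, ← Ideal.map_pow]
      exact Ideal.mem_map_of_mem _ hy
    · show _ = Ideal.Quotient.mk (Ideal.span {f}) (MvPolynomial.monomial (m c) 1) * _
      rw [← map_pow, hEq, map_mul]
  · -- the chart clause: p498340's relative lemma at `J = univ`
    intro c Q _ hQ
    exact CNConeFiModelRelBlowup.chartClause_of_cnData p k n Finset.univ ⟨⟨0, hn⟩, Finset.mem_univ _⟩ A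
      (fun j _ => hprim j) t V hV m a haA hgen hge f hfprime hXne (fun c S hS => hCN c S fun j => hS j (Finset.mem_univ j))
      dv g hg hndiv hface c Q hQ
  · -- zero locus of the centre = the origin
    intro P _
    rw [CNStrongPlusStepRel.centre_le_iff Finset.univ A (fun a ha => ?_) (fun j _ => hprim j) f P, Ideal.span_le]
    · constructor
      · intro h i
        exact h ⟨i, Finset.mem_coe.mpr (Finset.mem_univ i), rfl⟩
      · rintro h _ ⟨i, -, rfl⟩
        exact h i
    · have ha0 : a ≠ 0 := fun h => hA0 (h ▸ ha)
      obtain ⟨j, hj⟩ := Finsupp.ne_iff.mp ha0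
      exact ⟨j, Finset.mem_univ j, Nat.pos_of_ne_zero hj⟩

end Summit.ResolutionOfSingularities.ResolutionOfSingularities.Theorems.FInjectiveMacaulayfication.CNCertificates

end
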